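import Summits.Langlands.Langlands.Theorems.SoloBlindNewLineConic

/-!
# Solo-blind O1b, E78: LAW R (the two linear reciprocity equations) implies LAW Z2 (the conic)

Algebraic kernel of §5(q)(E6)(viii)–(ix) of the solo-blind Eisenstein study (`paper/theoremPhi.md`).

At level `N = q₁ q₂` (`qᵢ ≡ 1 (mod ℓ)`) the canonical vector `w_h = (s, r)` of the new Eisenstein line
satisfies, by LAW R (derived from Wake–Wang-Erickson's unramified-or-Steinberg relations and the Kummer
structure of the GMA cocycles), the two LINEAR equations
`12 m₁ s + (K₂₁ - G₂) r = u₁` and `(K₁₂ - G₁) s + 12 m₂ r = u₂`, where `G₁ = Γ₁ K₂₁ / K₁₂`,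
`G₂ = Γ₂ K₁₂ / K₂₁` and `Γᵢ` are the `ℓ`-th power residues of the `ℓ`-adically normalised
`ω²`-units of `ℚ(ζ_ℓ)⁺`.  **E78a** is the NORMAL FORM of the Z2 conic,
`-12 F = L_f · L_g - D · s r` with `L_f = 12 m₁ s + K₂₁ r - u₁`, `L_g = K₁₂ s + 12 m₂ r - u₂`,
`D = K₁₂ K₂₁ + 144 m₁ m₂ + 12 c₁₁`; **E78b**: LAW R together with the RECIPROCITY IDENTITY
`12 c₁₁ = G₁ G₂ - K₁₂ K₂₁ - 144 m₁ m₂` (verified for all 96 pairs `q₁ q₂ < 40000` at `ℓ = 5`)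
forces `F(s, r) = 0`, i.e. LAW Z2 — so the conic law is the shadow of two linear reciprocity laws.
-/

namespace Summit.Langlands.Langlands.Theorems

/-- **E78a (normal form of the Z2 conic).** With `12 c = 1`:
`-12 F(s,r) = (12 m₁ s + K₂₁ r - u₁)(K₁₂ s + 12 m₂ r - u₂) - (K₁₂ K₂₁ + 144 m₁ m₂ + 12 c₁₁) s r`. -/
theorem soloBlind_conic_normalForm {R : Type*} [CommRing R]
    (K₁₂ K₂₁ m₁ m₂ u₁ u₂ c c₁₁ s r : R) (hc : 12 * c = 1) :
    -(12 * soloBlindConic K₁₂ K₂₁ m₁ m₂ u₁ u₂ c c₁₁ s r) =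
      (12 * m₁ * s + K₂₁ * r - u₁) * (K₁₂ * s + 12 * m₂ * r - u₂)
        - (K₁₂ * K₂₁ + 144 * m₁ * m₂ + 12 * c₁₁) * s * r := by
  unfold soloBlindConic
  linear_combination (-(K₁₂ * u₁ * s + K₂₁ * u₂ * r - u₁ * u₂)) * hc

/-- **E78b (LAW R ⟹ LAW Z2).** If the canonical vector satisfies the two linear reciprocity equations
and the mixed Bernoulli moment satisfies the reciprocity identity, then it lies on the Z2 conic. -/
theorem soloBlind_lawR_implies_Z2 {R : Type*} [CommRing R]
    (K₁₂ K₂₁ m₁ m₂ u₁ u₂ c c₁₁ G₁ G₂ s r : R) (hc : 12 * c = 1)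
    (hE1 : 12 * m₁ * s + (K₂₁ - G₂) * r = u₁)
    (hE2 : (K₁₂ - G₁) * s + 12 * m₂ * r = u₂)
    (hrec : 12 * c₁₁ = G₁ * G₂ - K₁₂ * K₂₁ - 144 * m₁ * m₂) :
    soloBlindConic K₁₂ K₂₁ m₁ m₂ u₁ u₂ c c₁₁ s r = 0 := by
  unfold soloBlindConic
  linear_combination
    (-c * ((K₁₂ - G₁) * s + 12 * m₂ * r - u₂ + G₁ * s)) * hE1
      + (-c * G₂ * r) * hE2 + (c * s * r) * hrec
      + (c * (K₁₂ * u₁ * s + K₂₁ * u₂ * r - u₁ * u₂)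
          - (-(K₁₂ * m₁) * s ^ 2 + c₁₁ * s * r - (K₂₁ * m₂) * r ^ 2
              + (u₂ * m₁ + K₁₂ * u₁ * c) * s + (u₁ * m₂ + K₂₁ * u₂ * c) * r - u₁ * u₂ * c)) * hc

/-- **E78c (the pure case).** If the first coordinate vanishes, the second linear equation is
Mazur's: `12 m₂ r = u₂` — LAW R then predicts the pure `ψ_{q₂}` line through the Mazur point. -/
theorem soloBlind_lawR_pure {R : Type*} [CommRing R] (K₁₂ m₂ u₂ G₁ r : R)
    (hE2 : (K₁₂ - G₁) * 0 + 12 * m₂ * r = u₂) : 12 * m₂ * r = u₂ := by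
  simpa using hE2

end Summit.Langlands.Langlands.Theorems
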